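import Mathlib
import HarnessLib
import Literature.MathematicalPhysics.StatisticalMechanics.FluctuationKernelComparisonTraceTorusFRD
import Literature.MathematicalPhysics.StatisticalMechanics.FluctuationKernelComparisonSecondTransfer
import Literature.MathematicalPhysics.StatisticalMechanics.TorusFRDStepKernelConvex

/-!
# [ABKM19] Lemma 8.4 with `ℓ = 2`, SECOND-ORDER PART, for the step kernels of ONE `TorusFRD` package on the
# full torus: `‖R^{(q')}F − 2R^{½}F + R^{(q)}F‖_{k:k+1,X} ≤ b·(r₀+1)·27q_H²·h_T(q,q')²·κ^{|X|_k}`,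
# `h_T = (3^{d+1} L^{(N−k−1)d})^{1/2} · K Σ|q'−q| e^{2KΣ|q'−q|}` (volume-uniform at the last scale `k = N`)

Twin of `FluctuationKernelComparisonTraceTorusFRD.tayNormLE_fluct_sub_fluct_trace_of_torusFRD` (the `ℓ = 1`
full-torus form) for the genuine second-order part of the `ℓ = 2` comparison along the linear kernel segment
between `𝒞_{1+q,k+1}` and `𝒞_{1+q',k+1}` (`R^{½}` = integration against the midpoint kernel): same mode-wise
two-sided relative bound and shell count, fed to the second-order engine
`tayNormLE_fluct_secondDiff_of_sum_sq_transfer` with the trivial (identity) transfer.  Used at the last scale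
`k + 1 = N + 1`, where the factor `L^{(N−k−1)d}` is `1` (F4Φ22).

* **`tayNormLE_fluct_secondDiff_trace_of_torusFRD`**.

Everything is proved; no named fact.

## References
* S. Adams, S. Buchholz, R. Kotecký, S. Müller, arXiv:1910.13564, Lemma 8.4, Lemma 12.6
  [AdamsBuchholzKoteckyMuller2019].
* S. Buchholz, J. Funct. Anal. 275 (2018), Thm 4.5, (4.36)–(4.37) [Buchholz2016].
-/

noncomputable section

namespace Literature.MathematicalPhysics.StatisticalMechanics.GradientRG

open scoped BigOperators
open Real Set Finset MeasureTheory
open Literature.MathematicalPhysics.StatisticalMechanics.GradientFRD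
  (fourierCoeff cExt cExt_of_mem IsElliptic IsUnitSymm InShell iterDiff supNorm conv ellOp isElliptic_one
    exists_inShell inShell_le re_fourierCoeff_zero_of_sum_eq_zero)
open Literature.MathematicalPhysics.StatisticalMechanics.TorusPolymer (IsPolymer numBlocks)
open Literature.MathematicalPhysics.QuantumFieldTheory

variable {d M : ℕ} [NeZero M]

section Package

variable {L N Mord R n ñ : ℕ} {θbar lam μ δ₁ δ₀ A𝒫 : ℝ}
    {𝒞 : Matrix (Fin d) (Fin d) ℝ → ℕ → (Fin d → ZMod M) → ℝ} {Mc : ℕ → ℝ}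
    {Cα : (Fin d → ℕ) → ℕ → ℝ} {c C : ℝ} {Cℓ : ℕ → ℝ}

set_option maxHeartbeats 1600000 in
/-- **[ABKM19] Lemma 8.4 (`ℓ = 2`, second-order part), full-torus form for the step kernels `𝒞_{1+q',k+1}`,
`𝒞_{1+q,k+1}` of one `TorusFRD` package and their midpoint**: under the hypotheses of
`tayNormLE_fluct_sub_fluct_trace_of_torusFRD`,
`‖fluct 𝒞_{1+q'} F − 2•fluct (½𝒞_{1+q} + ½𝒞_{1+q'}) F + fluct 𝒞_{1+q} F‖_{k:k+1,X} ≤ b·((r₀+1)·27 q_H²·h_T²)·κ^{|X|_k}`,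
`h_T = (3^{d+1} L^{(N−(k+1))d})^{1/2} · (T e^{2KT} K)`, `T = Σ|q'−q|`, `κ = A𝒫(ρ'')^{1/p}`.
[cite: AdamsBuchholzKoteckyMuller2019, Lemma 8.4] -/
theorem tayNormLE_fluct_secondDiff_trace_of_torusFRD
    (hd : 3 ≤ d) (hMord : 1 ≤ Mord) (hMR : Mord ≤ R) (hLodd : Odd L) (hL : 2 ^ (d + 3) + 16 * R ≤ L)
    (hM : M = L ^ N)
    (hθbar : 0 < θbar) (hlam : 0 < lam) (hn : 2 * Mord ≤ n) (hn2 : 2 ≤ n) (hnñ : n ≤ ñ)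
    (hgap : d + 1 ≤ 2 * (ñ - n))
    (hc : 0 < c) (hC1 : 0 ≤ Cℓ 1)
    (hallA : ∀ A : Matrix (Fin d) (Fin d) ℝ, IsElliptic (1 / 2 : ℝ) 2 A →
        (∀ k, 1 ≤ k → k ≤ N + 1 →
          ∑ x : Fin d → ZMod M, 𝒞 A k x = 0 ∧ ∀ x, 𝒞 A k (-x) = 𝒞 A k x) ∧
        (∀ k, 1 ≤ k → k ≤ N + 1 → ∀ φ : (Fin d → ZMod M) → ℝ, ∑ x, φ x = 0 →
          0 ≤ ∑ x, ∑ y, φ x * 𝒞 A k (x - y) * φ y) ∧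
        (∀ φ : (Fin d → ZMod M) → ℝ, ∑ x, φ x = 0 →
          ellOp A (conv (fun x => ∑ k ∈ Finset.Icc 1 (N + 1), 𝒞 A k x) φ) = φ) ∧
        (∀ k, 1 ≤ k → k ≤ N → Mc k ≤ 0 ∧
          ∀ x : Fin d → ZMod M, ((L : ℝ) ^ k) / 2 ≤ (supNorm x : ℝ) →
            𝒞 A k x = Mc k) ∧
        (∀ k, 1 ≤ k → k ≤ N + 1 → ∀ B : Matrix (Fin d) (Fin d) ℝ, IsUnitSymm B →
          (∃ ε : ℝ, 0 < ε ∧ ∀ x : Fin d → ZMod M,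
            ContDiffOn ℝ ⊤ (fun s : ℝ => 𝒞 (A + s • B) k x) (Set.Ioo (-ε) ε)) ∧
          ∀ α : Fin d → ℕ, ∑ i, α i ≤ n → ∀ ℓ : ℕ, ∀ x : Fin d → ZMod M,
            abs (iteratedDeriv ℓ (fun s : ℝ => iterDiff α (𝒞 (A + s • B) k) x) 0)
              ≤ Cα α ℓ / (L : ℝ) ^ ((k - 1) * (d - 2 + ∑ i, α i))) ∧
        (∀ k, 1 ≤ k → k ≤ N + 1 → ∀ j : ℕ, ∀ κ : Fin d → ZMod M, κ ≠ 0 → InShell L j κ →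
          (j < k →
            c / (L : ℝ) ^ (2 * (d + ñ) + 1) * (L : ℝ) ^ (2 * j)
                / (L : ℝ) ^ ((k - j) * (d - 1 + n)) ≤ (fourierCoeff (𝒞 A k) κ).re ∧
            ‖fourierCoeff (𝒞 A k) κ‖
              ≤ C * (L : ℝ) ^ (2 * (d + ñ) + 1) * (L : ℝ) ^ (2 * j)
                  / (L : ℝ) ^ ((k - j) * (d - 1 + n))) ∧
          (k ≤ j →
            c / (L : ℝ) ^ (2 * (d + ñ) + 1) * (L : ℝ) ^ (2 * k)
                ≤ (fourierCoeff (𝒞 A k) κ).re ∧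
            ‖fourierCoeff (𝒞 A k) κ‖ ≤ C * (L : ℝ) ^ (2 * k)) ∧
          ∀ B : Matrix (Fin d) (Fin d) ℝ, IsUnitSymm B → ∀ ℓ : ℕ, 1 ≤ ℓ →
            (j < k →
              ‖iteratedDeriv ℓ (fun s : ℝ => fourierCoeff (𝒞 (A + s • B) k) κ) 0‖
                ≤ Cℓ ℓ * (L : ℝ) ^ (2 * (d + ñ) + 1) * (L : ℝ) ^ (2 * j)
                    / (L : ℝ) ^ ((k - j) * (d - 1 + ñ))) ∧
            (k ≤ j →
              ‖iteratedDeriv ℓ (fun s : ℝ => fourierCoeff (𝒞 (A + s • B) k) κ) 0‖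
                ≤ Cℓ ℓ * (L : ℝ) ^ (2 * k))))
    (hB : AbkmWeightBounds L N Mord R n θbar lam μ δ₁ δ₀ A𝒫 (fun j => 𝒞 1 j)
      (abkmWeightData L N Mord R θbar (schedDelta δ₀ δ₁ N) fun j => 𝒞 1 j))
    {k : ℕ} (hk : k + 1 ≤ N + 1) {ρ : ℝ} (hρ0 : 0 ≤ ρ) (hρ : ρ < θbar)
    {T₀ : ℝ} (hT₀ : T₀ ≤ 1 / 2) (hKT₀ : shellRatioConst c (Cℓ 1) (L : ℝ) d ñ * T₀ ≤ Real.log (1 + ρ))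
    {q q' : Matrix (Fin d) (Fin d) ℝ} (hq : q.IsSymm) (hq' : q'.IsSymm)
    (hqT : ∑ i, ∑ j, |q i j| ≤ T₀) (hq'T : ∑ i, ∑ j, |q' i j| ≤ T₀)
    {p qH ρ'' : ℝ} (hpq : p.HolderConjugate qH) (hρ''0 : 0 ≤ ρ'') (hρ'' : ρ'' < θbar)
    (hpρ : p * (1 + ρ) ≤ 1 + ρ'')
    {pT r₀ : ℕ} {h A : ℝ} {X : Finset (Fin d → ZMod M)} (hX : IsPolymer (L ^ k) X)
    {F : ((Fin d → ZMod M) → ℝ) → ℂ} {b : ℝ} (hb : 0 ≤ b) (hFd : ContDiff ℝ r₀ F)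
    (hFloc : IsGaugeLocal ((abkmNormParams L N Mord R pT r₀ h θbar A (schedDelta δ₀ δ₁ N)
      fun j => 𝒞 1 j).gauge k X) F)
    (hF : TayNormLE ((abkmNormParams L N Mord R pT r₀ h θbar A (schedDelta δ₀ δ₁ N) fun j => 𝒞 1 j).gauge k X)
      r₀ ((abkmWeightData L N Mord R θbar (schedDelta δ₀ δ₁ N) fun j => 𝒞 1 j).weight k X) F b) :
    TayNormLE ((abkmNormParams L N Mord R pT r₀ h θbar A (schedDelta δ₀ δ₁ N) fun j => 𝒞 1 j).gauge k X) r₀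
      ((abkmWeightData L N Mord R θbar (schedDelta δ₀ δ₁ N) fun j => 𝒞 1 j).midWeight k X)
      (fluct (𝒞 ((1 : Matrix (Fin d) (Fin d) ℝ) + q') (k + 1)) F -
        (2 : ℝ) • fluct (fun x => 2⁻¹ * 𝒞 ((1 : Matrix (Fin d) (Fin d) ℝ) + q) (k + 1) x +
          2⁻¹ * 𝒞 ((1 : Matrix (Fin d) (Fin d) ℝ) + q') (k + 1) x) F +
        fluct (𝒞 ((1 : Matrix (Fin d) (Fin d) ℝ) + q) (k + 1)) F)
      (b * ((r₀ + 1) * (27 * qH ^ 2 *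
          (Real.sqrt ((3 : ℝ) ^ (d + 1) * (L : ℝ) ^ ((N - (k + 1)) * d)) *
            ((∑ i, ∑ j, |(q' - q) i j|) *
              Real.exp (2 * shellRatioConst c (Cℓ 1) (L : ℝ) d ñ * ∑ i, ∑ j, |(q' - q) i j|) *
              shellRatioConst c (Cℓ 1) (L : ℝ) d ñ)) ^ 2)) *
        (weightIntConstRho θbar ρ'' (traceConst d Mord R lam (derivSum d n fun θ' _ => Cα θ' 0)) ^ (1 / p)) ^
          numBlocks (L ^ k) X) := by
  have h8 : 8 ≤ 2 ^ (d + 3) := by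
    calc 8 = 2 ^ 3 := by norm_num
      _ ≤ 2 ^ (d + 3) := Nat.pow_le_pow_right (by norm_num) (by omega)
  have hL2 : 2 ≤ L := by omega
  have hL5 : 5 ≤ L := by omega
  have hd1 : 1 ≤ d := by omega
  have hL0 : (0 : ℝ) ≤ (L : ℝ) := Nat.cast_nonneg _
  have hL1r : (1 : ℝ) ≤ (L : ℝ) := by exact_mod_cast (show 1 ≤ L by omega)
  have hp0 : 0 ≤ p := by linarith [hpq.lt]
  have hq2 : ∑ i, ∑ j, |q i j| ≤ 1 / 2 := hqT.trans hT₀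
  have hq'2 : ∑ i, ∑ j, |q' i j| ≤ 1 / 2 := hq'T.trans hT₀
  have hellq : IsElliptic (1 / 2 : ℝ) 2 ((1 : Matrix (Fin d) (Fin d) ℝ) + q) :=
    isElliptic_one_add_of_entrySum_le hq hq2
  have hellq' : IsElliptic (1 / 2 : ℝ) 2 ((1 : Matrix (Fin d) (Fin d) ℝ) + q') :=
    isElliptic_one_add_of_entrySum_le hq' hq'2
  -- constants
  set K := shellRatioConst c (Cℓ 1) (L : ℝ) d ñ with hKdef
  have hK0 : 0 ≤ K := shellRatioConst_nonneg hc hC1 hL0 d ñ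
  set T := ∑ i, ∑ j, |(q' - q) i j| with hTdef
  have hT0 : 0 ≤ T := sum_nonneg fun _ _ => sum_nonneg fun _ _ => abs_nonneg _
  set E := T * Real.exp (2 * K * T) with hEdef
  have hE0 : 0 ≤ E := by positivity
  set Kj : ℕ → ℝ := fun j => K / (L : ℝ) ^ ((k + 1 - j) * (ñ - n)) with hKjdef
  have hKj0 : ∀ j, 0 ≤ Kj j := fun j => by positivity
  have hKjle : ∀ j, Kj j ≤ K := fun j => div_le_self hK0 (one_le_pow₀ hL1r)
  -- the step-kernel data of the two ends and of the segment
  have hSa := stepKernelBounds_one_add_of_torusFRD hd hMord hMR hLodd hL hθbar hlam hn hn2 hnñ hc hC1 hallA hB hk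
    hρ0 hρ hT₀ hKT₀ hq' hq'T
  have hSb := stepKernelBounds_one_add_of_torusFRD hd hMord hMR hLodd hL hθbar hlam hn hn2 hnñ hc hC1 hallA hB hk
    hρ0 hρ hT₀ hKT₀ hq hqT
  have hSp : ∀ t ∈ Set.Icc (0 : ℝ) 1,
      StepKernelBounds (abkmWeightData L N Mord R θbar (schedDelta δ₀ δ₁ N) fun j => 𝒞 1 j) L k
        (weightIntConstRho θbar ρ'' (traceConst d Mord R lam (derivSum d n fun θ' _ => Cα θ' 0)))
        (p * secondDiffConst fun θ' => Cα θ' 0)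
        (fun x => p * (𝒞 ((1 : Matrix (Fin d) (Fin d) ℝ) + q) (k + 1) x +
          t * (𝒞 ((1 : Matrix (Fin d) (Fin d) ℝ) + q') (k + 1) x -
            𝒞 ((1 : Matrix (Fin d) (Fin d) ℝ) + q) (k + 1) x))) := fun t ht =>
    stepKernelBounds_const_mul_kernelSeg_of_torusFRD hd hMord hMR hLodd hL hθbar hlam hn hn2 hnñ hc hC1 hallA hB
      hk hρ0 hT₀ hKT₀ hq hq' hqT hq'T hp0 hρ''0 hρ'' hpρ ht.1 ht.2
  have hA𝒫p : 0 ≤ weightIntConstRho θbar ρ'' (traceConst d Mord R lam (derivSum d n fun θ' _ => Cα θ' 0)) :=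
    zero_le_one.trans (one_le_weightIntConstRho hθbar hρ''0 hρ''
      (traceConst_nonneg d Mord R hlam.le (derivSum_nonneg d n _)))
  have hoa := (hallA _ hellq').1 (k + 1) (by omega) hk
  have hob := (hallA _ hellq).1 (k + 1) (by omega) hk
  have hposa : ∀ κ : Fin d → ZMod M, κ ≠ 0 →
      0 < (fourierCoeff (𝒞 ((1 : Matrix (Fin d) (Fin d) ℝ) + q') (k + 1)) κ).re := fun κ hκ =>
    re_fourierCoeff_pos_of_torusFRD (hallA _ hellq').2.2.2.2.2 hc hL2 (by omega) hk hκ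
  have hposb : ∀ κ : Fin d → ZMod M, κ ≠ 0 →
      0 < (fourierCoeff (𝒞 ((1 : Matrix (Fin d) (Fin d) ℝ) + q) (k + 1)) κ).re := fun κ hκ =>
    re_fourierCoeff_pos_of_torusFRD (hallA _ hellq).2.2.2.2.2 hc hL2 (by omega) hk hκ
  have hnna : ∀ κ : Fin d → ZMod M, 0 ≤ (fourierCoeff (𝒞 ((1 : Matrix (Fin d) (Fin d) ℝ) + q') (k + 1)) κ).re := by
    intro κ
    by_cases hκ : κ = 0
    · rw [hκ, re_fourierCoeff_zero_of_sum_eq_zero hoa.1]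
    · exact (hposa κ hκ).le
  have hnnb : ∀ κ : Fin d → ZMod M, 0 ≤ (fourierCoeff (𝒞 ((1 : Matrix (Fin d) (Fin d) ℝ) + q) (k + 1)) κ).re := by
    intro κ
    by_cases hκ : κ = 0
    · rw [hκ, re_fourierCoeff_zero_of_sum_eq_zero hob.1]
    · exact (hposb κ hκ).le
  -- `StepKernelBounds` of the midpoint kernel
  have h1ρ : (1 : ℝ) * (1 + ρ) ≤ 1 + ρ := by rw [one_mul]
  have hSm : StepKernelBounds (abkmWeightData L N Mord R θbar (schedDelta δ₀ δ₁ N) fun j => 𝒞 1 j) L k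
      (weightIntConstRho θbar ρ (traceConst d Mord R lam (derivSum d n fun θ' _ => Cα θ' 0)))
      (1 * secondDiffConst fun θ' => Cα θ' 0)
      (fun x => 2⁻¹ * 𝒞 ((1 : Matrix (Fin d) (Fin d) ℝ) + q) (k + 1) x +
        2⁻¹ * 𝒞 ((1 : Matrix (Fin d) (Fin d) ℝ) + q') (k + 1) x) := by
    have h1 := stepKernelBounds_const_mul_convex3_of_torusFRD hd hMord hMR hLodd hL hθbar hlam hn hn2 hnñ hc hC1
      hallA hB hk hρ0 hT₀ hKT₀ hq hq hq' hqT hqT hq'T (p := 1) zero_le_one hρ0 hρ h1ρ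
      (a := 2⁻¹) (b := 0) (c₃ := 2⁻¹) (by norm_num) le_rfl (by norm_num) (by norm_num)
    have e : (fun x => (1 : ℝ) * (2⁻¹ * 𝒞 ((1 : Matrix (Fin d) (Fin d) ℝ) + q) (k + 1) x +
        0 * 𝒞 ((1 : Matrix (Fin d) (Fin d) ℝ) + q) (k + 1) x +
        2⁻¹ * 𝒞 ((1 : Matrix (Fin d) (Fin d) ℝ) + q') (k + 1) x)) =
        fun x => 2⁻¹ * 𝒞 ((1 : Matrix (Fin d) (Fin d) ℝ) + q) (k + 1) x +
          2⁻¹ * 𝒞 ((1 : Matrix (Fin d) (Fin d) ℝ) + q') (k + 1) x := by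
      funext x; ring
    rw [e] at h1
    exact h1
  -- the mode-wise relative bound `ρ(κ)`: `K_j T e^{2 K_j T}` on the shell `j(κ)` of a nonzero mode
  classical
  set ρm : (Fin d → ZMod M) → ℝ := fun κ =>
    if hκ : κ = 0 then 0 else
      Kj (Classical.choose (exists_inShell hL2 hκ)) * T *
        Real.exp (2 * (Kj (Classical.choose (exists_inShell hL2 hκ)) * T)) with hρmdef
  have hρm_nonneg : ∀ κ, 0 ≤ ρm κ := by
    intro κ
    simp only [hρmdef]
    split_ifs
    · exact le_rfl
    · exact mul_nonneg (mul_nonneg (hKj0 _) hT0) (Real.exp_pos _).le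
  have hρm0 : ρm 0 = 0 := by simp only [hρmdef, dif_pos]
  -- the two-sided mode-wise comparison
  have hshell : ∀ (κ : Fin d → ZMod M) (hκ : κ ≠ 0),
      |(fourierCoeff (𝒞 ((1 : Matrix (Fin d) (Fin d) ℝ) + q') (k + 1)) κ).re -
          (fourierCoeff (𝒞 ((1 : Matrix (Fin d) (Fin d) ℝ) + q) (k + 1)) κ).re| ≤
          ρm κ * (fourierCoeff (𝒞 ((1 : Matrix (Fin d) (Fin d) ℝ) + q') (k + 1)) κ).re ∧
        |(fourierCoeff (𝒞 ((1 : Matrix (Fin d) (Fin d) ℝ) + q') (k + 1)) κ).re -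
          (fourierCoeff (𝒞 ((1 : Matrix (Fin d) (Fin d) ℝ) + q) (k + 1)) κ).re| ≤
          ρm κ * (fourierCoeff (𝒞 ((1 : Matrix (Fin d) (Fin d) ℝ) + q) (k + 1)) κ).re := by
    intro κ hκ
    have hj := Classical.choose_spec (exists_inShell hL2 hκ)
    have h := abs_re_fourierCoeff_one_add_sub_le_shell_of_torusFRD (fun A hA => (hallA A hA).2.2.2.2.1)
      (fun A hA => (hallA A hA).2.2.2.2.2) hc hC1 hL2 hnñ hq hq' hq2 hq'2 (k := k + 1) (by omega) hk hκ hj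
    have hρκ : ρm κ = Kj (Classical.choose (exists_inShell hL2 hκ)) * T *
        Real.exp (2 * (Kj (Classical.choose (exists_inShell hL2 hκ)) * T)) := by
      simp only [hρmdef, dif_neg hκ]
    rw [hρκ]
    exact h
  have hcmpa : ∀ κ : Fin d → ZMod M,
      |(fourierCoeff (𝒞 ((1 : Matrix (Fin d) (Fin d) ℝ) + q') (k + 1)) κ).re -
          (fourierCoeff (𝒞 ((1 : Matrix (Fin d) (Fin d) ℝ) + q) (k + 1)) κ).re| ≤
        ρm κ * (fourierCoeff (𝒞 ((1 : Matrix (Fin d) (Fin d) ℝ) + q') (k + 1)) κ).re := by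
    intro κ
    by_cases hκ : κ = 0
    · rw [hκ, re_fourierCoeff_zero_of_sum_eq_zero hoa.1, re_fourierCoeff_zero_of_sum_eq_zero hob.1,
        sub_self, abs_zero, mul_zero]
    · exact (hshell κ hκ).1
  have hcmpb : ∀ κ : Fin d → ZMod M,
      |(fourierCoeff (𝒞 ((1 : Matrix (Fin d) (Fin d) ℝ) + q') (k + 1)) κ).re -
          (fourierCoeff (𝒞 ((1 : Matrix (Fin d) (Fin d) ℝ) + q) (k + 1)) κ).re| ≤
        ρm κ * (fourierCoeff (𝒞 ((1 : Matrix (Fin d) (Fin d) ℝ) + q) (k + 1)) κ).re := by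
    intro κ
    by_cases hκ : κ = 0
    · rw [hκ, re_fourierCoeff_zero_of_sum_eq_zero hoa.1, re_fourierCoeff_zero_of_sum_eq_zero hob.1,
        sub_self, abs_zero, mul_zero]
    · exact (hshell κ hκ).2
  -- the Hilbert–Schmidt sum over shells
  have hρm_shell : ∀ κ : Fin d → ZMod M, κ ≠ 0 →
      ∃ j, InShell L j κ ∧ |ρm κ| ≤ E * (K / (L : ℝ) ^ ((k + 1 - j) * (ñ - n))) := by
    intro κ hκ
    refine ⟨Classical.choose (exists_inShell hL2 hκ), Classical.choose_spec (exists_inShell hL2 hκ), ?_⟩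
    set j := Classical.choose (exists_inShell hL2 hκ) with hjdef
    rw [abs_of_nonneg (hρm_nonneg κ)]
    have hρκ : ρm κ = Kj j * T * Real.exp (2 * (Kj j * T)) := by simp only [hρmdef, dif_neg hκ, hjdef]
    rw [hρκ]
    have hexp : Real.exp (2 * (Kj j * T)) ≤ Real.exp (2 * K * T) := by
      refine Real.exp_le_exp.2 ?_
      have := mul_le_mul_of_nonneg_right (hKjle j) hT0
      linarith
    calc Kj j * T * Real.exp (2 * (Kj j * T)) ≤ Kj j * T * Real.exp (2 * K * T) :=
          mul_le_mul_of_nonneg_left hexp (mul_nonneg (hKj0 j) hT0)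
      _ = E * Kj j := by rw [hEdef]; ring
      _ = E * (K / (L : ℝ) ^ ((k + 1 - j) * (ñ - n))) := by rw [hKjdef]
  have hsum := sum_sq_le_of_shellRatio (d := d) hL5 hM (k := k + 1) hd1 hgap (E := E) (K := K) hρm0 hρm_shell
  set hS := Real.sqrt ((3 : ℝ) ^ (d + 1) * (L : ℝ) ^ ((N - (k + 1)) * d)) * (E * K) with hhSdef
  have hhS0 : 0 ≤ hS := by positivity
  have hsum' : ∑ κ, ρm κ ^ 2 ≤ hS ^ 2 := by
    rw [hhSdef, mul_pow, Real.sq_sqrt (by positivity)]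
    calc ∑ κ, ρm κ ^ 2 ≤ (3 : ℝ) ^ (d + 1) * (E * K) ^ 2 * (L : ℝ) ^ ((N - (k + 1)) * d) := hsum
      _ = (3 : ℝ) ^ (d + 1) * (L : ℝ) ^ ((N - (k + 1)) * d) * (E * K) ^ 2 := by ring
  -- the dimension-free Lemma 8.4
  have hmain := tayNormLE_fluct_secondDiff_of_sum_sq_transfer _ hB.isLocal hB.dominated hSa hSb hSm hpq hSp hoa.2
    hob.2 hoa.1 hob.1 hposa hposb (fun x => x) Finset.univ hoa.2 hob.2 hnna hnnb hposa hposb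
    (fun x _ y _ => rfl) (fun x _ y _ => rfl) hρm_nonneg hcmpa hcmpb hhS0 hsum' hX _ (gauge_const _ k X)
    (fun ζ ζ' hζ => by rw [show ζ = ζ' from funext fun x => hζ x (Finset.mem_univ x)]) hb hFd hFloc hF
  rw [pow_rpow_inv_eq_rpow_inv_pow hA𝒫p] at hmain
  convert hmain using 1
  rw [hhSdef, hEdef]
  ring

end Package

end Literature.MathematicalPhysics.StatisticalMechanics.GradientRG

end
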